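import Summits.BirchSwinnertonDyer.BirchSwinnertonDyer.Theorems.KolyvaginRoadThreePTDevissageTrivialPieces
import Summits.BirchSwinnertonDyer.BirchSwinnertonDyer.Theorems.SchneiderFreeAdditiveX3PoitouTateMuLevelMiddleExact
import HarnessLib

/-!
# Dévissage of Milne I Thm. 4.10(b) — `hE` for a TRIVIAL module of prime order (any carrier)

`middleExact_canonical_of_trivial_of_card_eq`: for a number field `K : Type`, a prime `p` (odd, or `K`
totally complex), and a finite discrete `Γ_K`-module `A` of order `p` with TRIVIAL action, Milne I
Thm. 4.10(b) `Ker γ¹ ⊆ Im β¹` holds for `A` and THE invariant maps `LocalInvariants.canonical K p` at every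
finite `S ⊇ {v ∣ ∞}` off which `v ∤ p`.  This is bsd-schneider door-c6 g7's `middleExact_canonical_trivial_level`
(carrier `ZMod p`, any trivial structure) transported along the intertwining isomorphism
`ZMod p ≃ A` (`addEquivOfPrimeCardEq`; trivial actions: `exists_intertwining_of_trivial`) by
`middleExact_of_equiv`.  With `tateDual_apply_eq_self_of_trivial` it also serves `A^D`, `B`, `B^D`, `B^{DD}`
of a unipotent `𝔽ₚ`-module over `K ∋ μₚ` — the inputs `hE₁`, `hE₃`, `hE₃D` of `middleExact_of_extension`.
Theorems only; no case of BSD.  References: [MilneADT2006] I Thm. 4.10(b).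
-/

noncomputable section

open CategoryTheory Function NumberField IsDedekindDomain
open scoped NumberField ContRepresentation

set_option linter.dupNamespace false
set_option autoImplicit false

namespace Summit.BirchSwinnertonDyer.BirchSwinnertonDyer.Theorems.KolyvaginRoadThreePT

open Field
open Literature.NumberTheory.GaloisRepresentations Literature.NumberTheory.GaloisCohomology
open Literature.NumberTheory.GaloisRepresentations.DiscreteGaloisModule (mu MuCarrier TateDual tateDual
  localTatePairingZMod unramifiedSubgroup)
open Summit.BirchSwinnertonDyer.BirchSwinnertonDyer.Theorems.SchneiderFreeAdditiveX3.PoitouTateReduction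

variable {K : Type} [Field K] [NumberField K] {p : ℕ} [hp : Fact p.Prime]
variable {A : Type} [AddCommGroup A] [TopologicalSpace A] [DiscreteTopology A] [Finite A]

/-- **Milne I Thm. 4.10(b) for a trivial module of prime order `p`, THE invariant maps, every admissible
`S`** (transport of `middleExact_canonical_trivial_level` along `ZMod p ≃ A`).
[cite: MilneADT2006, Ch. I, Thm. 4.10(b)] -/
theorem middleExact_canonical_of_trivial_of_card_eq (harch : ∀ w : InfinitePlace K, w.IsReal → Odd p)
    (ρA : DiscreteGaloisModule K A) (hA : ∀ (σ : absoluteGaloisGroup K) (a : A), ρA σ a = a)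
    (hcard : Nat.card A = p) (S : Finset (Place K))
    (hinf : ∀ w : InfinitePlace K, (Sum.inl w : Place K) ∈ S)
    (hS : ∀ v : HeightOneSpectrum (𝓞 K), (Sum.inr v : Place K) ∉ S → ((p : ℕ) : 𝓞 K) ∉ v.asIdeal)
    (t : Π v : Place K, galoisCohomology (ρA.toLocal v) 1)
    (horth : ∀ y : galoisCohomology (ρA.tateDual p) 1,
      (∀ v : HeightOneSpectrum (𝓞 K), (Sum.inr v : Place K) ∉ S →
        galoisCohomology.localization (ρA.tateDual p) (Sum.inr v) 1 y ∈
          unramifiedSubgroup (GaloisRep.toLocal v (ρA.tateDual p)) 1) →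
      ∑ v ∈ S, localTatePairingZMod ρA p v (LocalInvariants.canonical K p v) (t v)
        (galoisCohomology.localization (ρA.tateDual p) v 1 y) = 0) :
    ∃ x : galoisCohomology ρA 1,
      (∀ v : HeightOneSpectrum (𝓞 K), (Sum.inr v : Place K) ∉ S →
        galoisCohomology.localization ρA (Sum.inr v) 1 x ∈ unramifiedSubgroup (GaloisRep.toLocal v ρA) 1) ∧
      ∀ v ∈ S, galoisCohomology.localization ρA v 1 x = t v := by
  haveI : NeZero p := ⟨hp.out.ne_zero⟩
  -- the trivial structure on the carrier `ZMod p` and the isomorphism `ZMod p ≃ A`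
  let ρ₀ : DiscreteGaloisModule K (ZMod p) := ContinuousRep.trivial (absoluteGaloisGroup K) ℤ (ZMod p)
  have h₀ : ∀ (σ : absoluteGaloisGroup K) (m : ZMod p), ρ₀ σ m = m := fun σ m => rfl
  let e : ZMod p ≃+ A := addEquivOfPrimeCardEq (Nat.card_zmod p) hcard
  obtain ⟨ι, hι⟩ := exists_intertwining_of_trivial ρ₀ ρA h₀ hA e.toAddMonoidHom
  obtain ⟨κ, hκ⟩ := exists_intertwining_of_trivial ρA ρ₀ hA h₀ e.symm.toAddMonoidHom
  have hικ : ∀ a : A, ι (κ a) = a := fun a => by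
    rw [hι, hκ]
    exact e.apply_symm_apply a
  exact middleExact_of_equiv (LocalInvariants.canonical K p) ρ₀ ρA ι κ hικ
    (middleExact_canonical_trivial_level (n := p) harch ρ₀ h₀ S hinf hS) t horth

end Summit.BirchSwinnertonDyer.BirchSwinnertonDyer.Theorems.KolyvaginRoadThreePT

end
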